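import Literature.Computability.Learning.CryptoHardnessGames
import HarnessLib

/-!
# Pseudorandom functions are not polynomially PAC-predictable: the proof

Discharge of the named fact `Literature.Computability.Learning.prf_not_polyPACPredictable`
(`CryptoHardness.lean`; Goldreich–Goldwasser–Micali 1986, §3; Kearns–Valiant 1994, §3;
Oliveira–Santhanam 2017, §4, Prop. 1 "learning `𝔠` implies no PRFs in `𝔠`", uniform PPT instance).
Given a `PolyPACPredictable` learner `(A, E)` (membership queries, uniform examples) for a class `𝒞`
containing all keyed first-bit functions of a PRF `F` (`ℓin = id`, `ℓout ≥ 1`), the oracle adversary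
`LearnerDistinguisher.distinguisher A E pt (pc ∘ (X+16)) (pt₂ ∘ (X+16))` of
`CryptoHardnessMachine.lean` is probabilistic polynomial-time (`isPPT_distinguisher`) and, by the two
game bounds of `CryptoHardnessGames.lean`, has advantage

  `adv(n) ≥ 7/32 · 2^{-(L₁+L₂)} − (T'(n) + 1)/2ⁿ ≥ c / Q(n) − R(n)/2ⁿ`

for polynomials `Q`, `R` (`prfAdvantage_distinguisher_ge`) — which is not negligible
(`not_superpolynomialDecay_of_ge`), contradicting `IsPRF`.

## References

* O. Goldreich, S. Goldwasser, S. Micali, J. ACM 33 (1986) 792–807, §3 [GoldreichGoldwasserMicali1986].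
* M. Kearns, L. Valiant, J. ACM 41 (1994) 67–95, §3 [KearnsValiant1994].
* I. C. Oliveira, R. Santhanam, CCC 2017 (arXiv:1611.01190), §4, Prop. 1 [OliveiraSanthanam2017].
-/

noncomputable section

namespace Literature.Computability.Learning

open _root_.Computability Complexity Complexity.OracleAlg Cryptography Polynomial Finset Filter Asymptotics
open LearnerDistinguisher

open scoped Classical Topology

/-! ### Polynomial growth -/

/-- An `ℕ`-polynomial is bounded by its value at `1` times `n^{deg}` for `n ≥ 1` (twin of
`Complexity.natPoly_eval_le_eval_one_mul_pow`, `CircuitLowerBounds.lean`, outside this file's import cone).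
[folklore] -/
theorem eval_le_eval_one_mul_pow (p : Polynomial ℕ) {n : ℕ} (hn : 1 ≤ n) : p.eval n ≤ p.eval 1 * n ^ p.natDegree := by
  rw [eval_eq_sum_range, eval_eq_sum_range, sum_mul]
  refine sum_le_sum fun i hi => ?_
  rw [mem_range] at hi
  rw [one_pow, mul_one]
  exact Nat.mul_le_mul_left _ (Nat.pow_le_pow_right hn (by omega))

/-- **A sequence bounded below by `c/Q(n) − R(n)/2ⁿ` (`c > 0`, `Q`, `R` polynomials) is not negligible.**
[Goldreich 2001, §1.3 (negligible functions)] [folklore] -/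
theorem not_superpolynomialDecay_of_ge (f : ℕ → ℝ) {c : ℝ} (hc : 0 < c) (Q R : Polynomial ℕ)
    (hf : ∀ᶠ n in atTop, c / (Q.eval n + 1) - (R.eval n + 1) / 2 ^ n ≤ f n) :
    ¬SuperpolynomialDecay atTop (fun n : ℕ => (n : ℝ)) f := by
  intro hdecay
  set D := Q.natDegree with hD
  set DR := R.natDegree with hDR
  -- (1) `n^{D+1} f n → 0`, so eventually `< 1`
  have h1 : ∀ᶠ n : ℕ in atTop, (n : ℝ) ^ (D + 1) * f n < 1 :=
    (hdecay (D + 1)).eventually_lt_const zero_lt_one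
  -- (2) the exponential term: `n^{D+1} (R n + 1)/2ⁿ ≤ (R 1 + 1) · n^{D+1+DR}/2ⁿ → 0`
  have h2 : ∀ᶠ n : ℕ in atTop, (n : ℝ) ^ (D + 1) * ((R.eval n + 1 : ℝ) / 2 ^ n) ≤ 1 := by
    have ht := (tendsto_pow_const_div_const_pow_of_one_lt (D + 1 + DR) one_lt_two).eventually_lt_const
      (show (0 : ℝ) < 1 / (R.eval 1 + 1 : ℝ) by positivity)
    filter_upwards [ht, eventually_ge_atTop 1] with n hn hn1
    have hR : (R.eval n + 1 : ℝ) ≤ (R.eval 1 + 1 : ℝ) * (n : ℝ) ^ DR := by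
      have h := eval_le_eval_one_mul_pow R hn1
      have h1' : (1 : ℝ) ≤ (n : ℝ) ^ DR := one_le_pow₀ (by exact_mod_cast hn1)
      calc (R.eval n + 1 : ℝ) ≤ R.eval 1 * (n : ℝ) ^ DR + 1 := by exact_mod_cast Nat.add_le_add_right h 1
        _ ≤ (R.eval 1 + 1 : ℝ) * (n : ℝ) ^ DR := by nlinarith
    have hpos : (0 : ℝ) < R.eval 1 + 1 := by positivity
    rw [lt_div_iff₀ hpos] at hn
    calc (n : ℝ) ^ (D + 1) * ((R.eval n + 1 : ℝ) / 2 ^ n)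
        ≤ (n : ℝ) ^ (D + 1) * ((R.eval 1 + 1 : ℝ) * (n : ℝ) ^ DR / 2 ^ n) := by gcongr
      _ = (n : ℝ) ^ (D + 1 + DR) / 2 ^ n * (R.eval 1 + 1 : ℝ) := by rw [pow_add]; ring
      _ ≤ 1 := hn.le
  -- (3) the polynomial term: `n^{D+1} · c/(Q n + 1) ≥ c n/(Q 1 + 1)`
  have h3 : ∀ᶠ n : ℕ in atTop, c / (Q.eval 1 + 1 : ℝ) * n ≤ (n : ℝ) ^ (D + 1) * (c / (Q.eval n + 1 : ℝ)) := by
    filter_upwards [eventually_ge_atTop 1] with n hn1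
    have hQ : (Q.eval n + 1 : ℝ) ≤ (Q.eval 1 + 1 : ℝ) * (n : ℝ) ^ D := by
      have h := eval_le_eval_one_mul_pow Q hn1
      have h1' : (1 : ℝ) ≤ (n : ℝ) ^ D := one_le_pow₀ (by exact_mod_cast hn1)
      calc (Q.eval n + 1 : ℝ) ≤ Q.eval 1 * (n : ℝ) ^ D + 1 := by exact_mod_cast Nat.add_le_add_right h 1
        _ ≤ (Q.eval 1 + 1 : ℝ) * (n : ℝ) ^ D := by nlinarith
    have hQpos : (0 : ℝ) < Q.eval n + 1 := by positivity
    have hQ1pos : (0 : ℝ) < Q.eval 1 + 1 := by positivity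
    rw [div_mul_eq_mul_div, ← mul_div_assoc, div_le_div_iff₀ hQ1pos hQpos, pow_succ]
    have hn0 : (0 : ℝ) ≤ n := Nat.cast_nonneg n
    have hcn : 0 ≤ c * (n : ℝ) := mul_nonneg hc.le hn0
    calc c * (n : ℝ) * (Q.eval n + 1 : ℝ) ≤ c * (n : ℝ) * ((Q.eval 1 + 1 : ℝ) * (n : ℝ) ^ D) :=
          mul_le_mul_of_nonneg_left hQ hcn
      _ = (n : ℝ) ^ D * (n : ℝ) * c * (Q.eval 1 + 1 : ℝ) := by ring
  -- (4) a large `n`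
  have h4 : ∀ᶠ n : ℕ in atTop, (3 : ℝ) ≤ c / (Q.eval 1 + 1 : ℝ) * n := by
    have hpos : (0 : ℝ) < c / (Q.eval 1 + 1 : ℝ) := by positivity
    filter_upwards [eventually_ge_atTop ⌈3 / (c / (Q.eval 1 + 1 : ℝ))⌉₊] with n hn
    have hn' : 3 / (c / (Q.eval 1 + 1 : ℝ)) ≤ n := (Nat.le_ceil _).trans (by exact_mod_cast hn)
    rw [div_le_iff₀ hpos, mul_comm] at hn'
    exact hn'
  obtain ⟨n, hn1, hn2, hn3, hn4, hnf⟩ := (h1.and (h2.and (h3.and (h4.and hf)))).exists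
  have : (n : ℝ) ^ (D + 1) * (c / (Q.eval n + 1 : ℝ) - (R.eval n + 1 : ℝ) / 2 ^ n) ≤ (n : ℝ) ^ (D + 1) * f n :=
    mul_le_mul_of_nonneg_left hnf (by positivity)
  rw [mul_sub] at this
  linarith

/-! ### The real game, averaged over the key -/

/-- **Averaging a per-key bound**: if the adversary accepts every keyed oracle `F n k` (`|k| = κ n`) with
probability `≥ B`, then `prfRealProb ≥ B`. [Goldreich 2001, Def. 3.6.4] [folklore] -/
theorem le_prfRealProb_of_forall (F : FunctionEnsemble) (κ ℓin : ℕ → ℕ) (𝒜 : OracleAdversary Bool) (n : ℕ) {B : ℝ}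
    (h : ∀ k : List Bool, k.length = κ n → B ≤ 𝒜.acceptProb (oracleOfFnAt (ℓin n) (F n k)) n) :
    B ≤ prfRealProb F κ ℓin 𝒜 n := by
  have hsum : prfRealProb F κ ℓin 𝒜 n = ∑ v : List.Vector Bool (κ n),
      ((Fintype.card (List.Vector Bool (κ n)) : ENNReal))⁻¹.toReal * 𝒜.acceptProb (oracleOfFnAt (ℓin n) (F n v.toList)) n := by
    rw [prfRealProb, prfRealPMF, uniformBits, PMF.bind_map, PMF.bind_apply, tsum_fintype,
      ENNReal.toReal_sum (fun v _ => ENNReal.mul_ne_top (by simp) (PMF.apply_ne_top _ _))]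
    refine sum_congr rfl fun v _ => ?_
    rw [ENNReal.toReal_mul, PMF.uniformOfFintype_apply]
    rfl
  rw [hsum]
  have hN : (0 : ℝ) < Fintype.card (List.Vector Bool (κ n)) := by exact_mod_cast Fintype.card_pos
  calc B = ∑ _v : List.Vector Bool (κ n), ((Fintype.card (List.Vector Bool (κ n)) : ENNReal))⁻¹.toReal * B := by
        rw [sum_const, card_univ, nsmul_eq_mul, ENNReal.toReal_inv, ENNReal.toReal_natCast]
        field_simp
    _ ≤ _ := sum_le_sum fun v _ => mul_le_mul_of_nonneg_left (h v.toList v.toList_length) ENNReal.toReal_nonneg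

/-! ### The advantage of the distinguisher -/

/-- `⌈1/(1/8)⌉₊ = 8`. [folklore] -/
theorem invCeil_one_div_eight : invCeil (1 / 8 : ℝ) = 8 := by
  rw [invCeil]; norm_num

section Assembly

variable {F : FunctionEnsemble} {κ ℓout : ℕ → ℕ} {𝒞 : ConceptClass} {A : OracleAlg (List Bool)} {E : OracleAlg Bool}
  {coins t t₂ : ℕ → ℕ → ℕ → ℕ} {pc pt pt₂ : Polynomial ℕ}

/-- **The advantage of the learner-built distinguisher**: with `qA = pt`, `P₁ = pc ∘ (X + 16)`,
`P₂ = pt₂ ∘ (X + 16)` (polynomial bounds of the round, coin and evaluation budgets),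
`real(n) − ideal(n) ≥ 7/32 · 2^{-(L₁+L₂)} − (T'(n)+1)/2ⁿ`. [GGM 1986, §3; Kearns–Valiant 1994, §3;
Oliveira–Santhanam 2017, §4 Prop. 1] [folklore] -/
theorem prfAdvantage_distinguisher_ge (hEff : IsEfficientFamily F κ id ℓout) (hout : ∀ n, 1 ≤ ℓout n)
    (hF : ∀ (n : ℕ) (k : List Bool), k.length = κ n → F.boolFn n k ∈ 𝒞 n)
    (hpc : ∀ n a b, coins n a b ≤ pc.eval (n + a + b)) (hpt : ∀ n a b, t n a b ≤ pt.eval (n + a + b))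
    (hpt₂ : ∀ n a b, t₂ n a b ≤ pt₂.eval (n + a + b))
    (hL : IsPACPredictorFor uniformDistributions true 𝒞 A E coins t t₂) (n : ℕ) :
    7 / 32 / 2 ^ guessBits (pc.comp (X + 16)) (pt₂.comp (X + 16)) n -
        (pt.eval ((inputBoundPoly (pc.comp (X + 16))).eval n) + 1) / 2 ^ n ≤
      prfRealProb F κ id (distinguisher A E pt (pc.comp (X + 16)) (pt₂.comp (X + 16))) n -
        prfIdealProb id ℓout (distinguisher A E pt (pc.comp (X + 16)) (pt₂.comp (X + 16))) n := by
  set P₁ := pc.comp (X + 16) with hP₁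
  set P₂ := pt₂.comp (X + 16) with hP₂
  set cstar := coins n 8 8 with hcstar
  set Tstar := t n 8 8 with hTstar
  set T₂star := t₂ n 8 8 with hT₂star
  have hP₁n : P₁.eval n = pc.eval (n + 16) := by simp [hP₁]
  have hP₂n : P₂.eval n = pt₂.eval (n + 16) := by simp [hP₂]
  have hc1 : cstar ≤ P₁.eval n := by rw [hP₁n]; exact hpc n 8 8
  have hc : cstar < 2 ^ guessLen P₁ n := lt_of_le_of_lt hc1 (lt_two_pow_guessLen P₁ n)
  have hT₂ : T₂star < 2 ^ guessLen P₂ n := lt_of_le_of_lt (by rw [hP₂n]; exact hpt₂ n 8 8) (lt_two_pow_guessLen P₂ n)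
  have hT : Tstar ≤ pt.eval (4 * n + 58 + cstar) := (hpt n 8 8).trans (TM2Iter.eval_mono pt (by omega))
  -- the coin layout
  have hgb : guessBits P₁ P₂ n ≤ (P₁.eval n + 1) + (P₂.eval n + 1) :=
    Nat.add_le_add (guessLen_le P₁ n) (guessLen_le P₂ n)
  have hTfuel : Tstar ≤ (fuelPoly pt P₁).eval n := by
    refine hT.trans ?_
    simp only [fuelPoly, inputBoundPoly, eval_add, eval_comp, eval_mul, eval_ofNat, eval_X, eval_one]
    refine (TM2Iter.eval_mono pt ?_).trans (Nat.le_add_right _ _)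
    omega
  set d := (coinsPoly pt P₁ P₂).eval n - (guessBits P₁ P₂ n + 2 * n) with hd
  have hCval : (coinsPoly pt P₁ P₂).eval n = (P₁.eval n + 1) + (P₂.eval n + 1) + 2 * n + 2 * (P₁.eval n + 1) +
      ((fuelPoly pt P₁).eval n + 2) * n := by
    simp [coinsPoly]
  have hC : (coinsPoly pt P₁ P₂).eval n = guessBits P₁ P₂ n + 2 * n + d := by rw [hd]; omega
  have hdR : rulerLen P₁ n + Tstar * n ≤ d := by
    rw [hd, hCval, rulerLen]
    have : Tstar * n ≤ ((fuelPoly pt P₁).eval n + 2) * n := Nat.mul_le_mul_right n (by omega)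
    omega
  -- the real game, key by key
  have hreal : 1 / 2 + 7 / 32 / 2 ^ guessBits P₁ P₂ n ≤ prfRealProb F κ id (distinguisher A E pt P₁ P₂) n := by
    refine le_prfRealProb_of_forall F κ id _ n fun k hk => ?_
    have h𝒪 : ∀ y : List Bool, y.length = n → oracleOfFnAt (id n) (F n k) y ≠ [] := by
      intro y hy habs
      have h1 := hEff.2.2 n k y hk hy
      rw [oracleOfFnAt_apply_of_length_eq (m := id n) (F n k) hy] at habs
      rw [habs] at h1
      have := hout n
      simp at h1; omega
    have hf : ∀ x : Fin n → Bool, F.boolFn n k x = headFn (oracleOfFnAt (id n) (F n k)) (List.ofFn x) := by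
      intro x
      rw [headFn, oracleOfFnAt_apply_of_length_eq (m := id n) (F n k) (by simp)]
      rfl
    have hPAC := hL n (F.boolFn n k) (hF n k hk) (PMF.uniformOfFintype _) rfl (1 / 8) (1 / 8) (by norm_num) (by norm_num)
      (by norm_num) (by norm_num)
    rw [invCeil_one_div_eight, show (1 : ℝ) - 1 / 8 = 7 / 8 by norm_num] at hPAC
    exact acceptProb_real_ge A E pt P₁ P₂ (oracleOfFnAt (id n) (F n k)) hf h𝒪 hc hT₂ hT hdR hC hPAC
  -- the ideal game
  have hideal : prfIdealProb id ℓout (distinguisher A E pt P₁ P₂) n ≤ 1 / 2 + (pt.eval ((inputBoundPoly P₁).eval n) + 1) / 2 ^ n :=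
    idealProb_le A E pt P₁ P₂ (hout n) (d := d) (by rw [hC]; ring)
  linarith

/-- **The PRF advantage of the distinguisher is not negligible.** [GGM 1986, §3; Oliveira–Santhanam 2017, §4 Prop. 1] [folklore] -/
theorem not_superpolynomialDecay_prfAdvantage (hEff : IsEfficientFamily F κ id ℓout) (hout : ∀ n, 1 ≤ ℓout n)
    (hF : ∀ (n : ℕ) (k : List Bool), k.length = κ n → F.boolFn n k ∈ 𝒞 n)
    (hpc : ∀ n a b, coins n a b ≤ pc.eval (n + a + b)) (hpt : ∀ n a b, t n a b ≤ pt.eval (n + a + b))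
    (hpt₂ : ∀ n a b, t₂ n a b ≤ pt₂.eval (n + a + b))
    (hL : IsPACPredictorFor uniformDistributions true 𝒞 A E coins t t₂) :
    ¬SuperpolynomialDecay atTop (fun n : ℕ => (n : ℝ))
      (prfAdvantage F κ id ℓout (distinguisher A E pt (pc.comp (X + 16)) (pt₂.comp (X + 16)))) := by
  refine not_superpolynomialDecay_of_ge _ (show (0 : ℝ) < 7 / 32 by norm_num)
    (4 * (pc.comp (X + 16) + 1) * (pt₂.comp (X + 16) + 1)) (pt.comp (inputBoundPoly (pc.comp (X + 16))))
    (Eventually.of_forall fun n => ?_)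
  have hadv := prfAdvantage_distinguisher_ge hEff hout hF hpc hpt hpt₂ hL n
  set P₁ := pc.comp (X + 16) with hP₁
  set P₂ := pt₂.comp (X + 16) with hP₂
  -- `2^{L₁+L₂} ≤ Q(n)` and `T'(n) = R(n)`
  have h2a : (2 : ℝ) ^ guessBits P₁ P₂ n ≤ ((4 * (P₁ + 1) * (P₂ + 1)).eval n : ℕ) := by
    have h1 := two_pow_guessLen_le P₁ n
    have h2 := two_pow_guessLen_le P₂ n
    have h : 2 ^ guessBits P₁ P₂ n ≤ (4 * (P₁ + 1) * (P₂ + 1)).eval n := by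
      rw [guessBits, pow_add]
      simp only [eval_mul, eval_add, eval_ofNat, eval_one]
      calc 2 ^ guessLen P₁ n * 2 ^ guessLen P₂ n ≤ (2 * (P₁.eval n + 1)) * (2 * (P₂.eval n + 1)) :=
            Nat.mul_le_mul h1 h2
        _ = 4 * (P₁.eval n + 1) * (P₂.eval n + 1) := by ring
    exact_mod_cast h
  have hRn : ((pt.eval ((inputBoundPoly P₁).eval n) : ℕ) : ℝ) = (((pt.comp (inputBoundPoly P₁)).eval n : ℕ) : ℝ) := by
    rw [eval_comp]
  have hle1 : (7 / 32 : ℝ) / (((4 * (P₁ + 1) * (P₂ + 1)).eval n : ℕ) + 1) ≤ 7 / 32 / 2 ^ guessBits P₁ P₂ n :=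
    div_le_div_of_nonneg_left (by norm_num) (by positivity) (h2a.trans (by linarith))
  rw [prfAdvantage, ← hRn]
  calc (7 / 32 : ℝ) / (((4 * (P₁ + 1) * (P₂ + 1)).eval n : ℕ) + 1) - ((pt.eval ((inputBoundPoly P₁).eval n) : ℕ) + 1) / 2 ^ n
      ≤ 7 / 32 / 2 ^ guessBits P₁ P₂ n - ((pt.eval ((inputBoundPoly P₁).eval n) : ℕ) + 1) / 2 ^ n :=
        sub_le_sub_right hle1 _
    _ ≤ _ := hadv
    _ ≤ _ := le_abs_self _

/-- **Discharge of `prf_not_polyPACPredictable`.** [GGM 1986, §3; Kearns–Valiant 1994, §3;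
Oliveira–Santhanam 2017, §4 Prop. 1] [cite: OliveiraSanthanam2017, §4 Prop. 1] -/
theorem prf_not_polyPACPredictable_holds : prf_not_polyPACPredictable := by
  intro F κ ℓout hprf hout 𝒞 hF hL
  obtain ⟨A, E, coins, t, t₂, hA, hE, ⟨pc, hpc⟩, ⟨pt, hpt⟩, ⟨pt₂, hpt₂⟩, hPAC⟩ := hL
  have hPPT : (distinguisher A E pt (pc.comp (X + 16)) (pt₂.comp (X + 16))).IsPPT encodingBoolBool :=
    isPPT_distinguisher pt (pc.comp (X + 16)) (pt₂.comp (X + 16)) hA hE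
  exact not_superpolynomialDecay_prfAdvantage hprf.1 hout hF hpc hpt hpt₂ hPAC (hprf.2 _ hPPT)

end Assembly

end Literature.Computability.Learning
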